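import Literature.Probability.RandomPlanarGeometry.HexSAWSurfaceYcLimit
import Mathlib.Analysis.MeanInequalities
import Mathlib.Analysis.SpecialFunctions.Pow.Real
import HarnessLib

/-!
# «HEX-YC-DENSITY-SUB» The mean density of surface vertices of honeycomb half-plane walks:
# `→ 0` for `y < y_c = 1 + √2` with exponentially small tails, bounded below for `y > y_c`

Topic `Literature/Probability/RandomPlanarGeometry` (continues `HexSAWSurfaceYcGrowth.lean` — `HV.hpCoeff n y = C_n(y)`,
`GrowthLe` / `GrowthGt`, `growthLe_criticalPoint`, `growthGt_holds` — and `HexSAWSurfaceYcLimit.lean` — the EVENTUAL lower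
rates `GrowthGeRate`, `growthGeRate_mu_of_pos`, `growthGeRate_sqrt`; DCS orientation of the surface).

Source: N. R. Beaton, M. Bousquet-Mélou, J. de Gier, H. Duminil-Copin, A. J. Guttmann, *The critical fugacity for surface
adsorption of self-avoiding walks on the honeycomb lattice is `1 + √2`*, Comm. Math. Phys. 326 (2014) (arXiv:1109.0358v5),
§3.1, its last paragraph (arXiv v5 p. 10; page and sentence verified on the v5 PDF by the lane's literature seat, 2026-08-23):
"The critical value `y_c`, which we have defined in analytic terms, can also be given a probabilistic description … we see
that the density of vertices on the surface is `0` for `y < y_c` and is positive for `y > y_c`: in other words, the critical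
value `y_c` distinguishes between the desorbed and adsorbed phases."  The same paragraph displays the mean density of vertices
in the surface, `(1/n) Σ_i i c_n^+(i) y^i / Σ_i c_n^+(i) y^i = (y/n) ∂ log C_n^+(y)/∂y`, and its `n → ∞` limit
`y ∂ log μ(y)/∂y` (formula tokens read on the arXiv source held in the lane's store — an earlier arXiv version whose
surrounding sentences differ from v5; the identical formula is printed for the rotated orientation in N. R. Beaton,
J. Phys. A 47 (2014) 075003, §3.1, arXiv:1210.0274v3 p. 14).  The printed route goes through the LIMIT free energy
`log μ(y)` (Hammersley–Torrie–Whittington 1982), its convexity and the exchange of limit and derivative.  This file proves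
junk-free FINITE-`n` statements directly from the growth rates in the tree, with no limit free energy, no derivative and
no convexity argument other than one weighted AM–GM step:

* vocabulary: the length-`n` fibre `hpFibreN n` (the index set of `C_n(y)`), the surface moment
  `surfMoment n y = Σ_γ c(γ) y^{c(γ)} = y C_n'(y)`, the **mean density `surfDensity n y = surfMoment n y / (n C_n(y))`**
  (the printed left-hand side), the tail `surfTail n t y = Σ_{γ : c(γ) ≥ t} y^{c(γ)}`; `0 ≤ surfDensity n y ≤ 1`;
* `surfMoment_le_add` (Markov splitting `Σ c y^c ≤ t C_n(y) + n · surfTail n t y`) and the rescaling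
  `surfTail_le_pow_mul : surfTail n t y ≤ (y/y')^t C_n(y')` (`0 < y ≤ y'`);
* **`exists_rate_surfTail`** — for `0 < y < 1 + √2` and `ε > 0` there is `ρ < μ` with `surfTail n ⌈εn⌉ y ≤ ρⁿ`
  eventually (rescale to `y' = y_c` and use `limsup C_n(y_c)^{1/n} ≤ μ`, `growthLe_criticalPoint`); with the eventual
  lower rate `growthGeRate_mu_of_pos` this gives **`exists_rate_surfTail_div`**: the Boltzmann probability of `≥ εn`
  surface vertices is `≤ θⁿ` eventually, `θ < 1`;
* **`tendsto_surfDensity_zero` — for `0 < y < 1 + √2`, `surfDensity n y → 0`** ("the density … is `0` for `y < y_c`",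
  finite-`n` form);
* the chord inequality **`rpow_surfDensity_le : (y₀/y)^{surfMoment n y / C_n(y)} ≤ C_n(y₀)/C_n(y)`** (weighted AM–GM =
  convexity of `log C_n(eᵗ)`), whence `le_surfDensity_of_ratio_le`; with `growthGt_holds` (a rate `> μ` reached
  infinitely often above `y_c`) **`frequently_le_surfDensity_of_gt` — for `y > 1 + √2` some `δ > 0` has
  `δ ≤ surfDensity n y` for infinitely many `n`**, and with the zig-zag rate `√y > μ` (`growthGeRate_sqrt`)
  **`eventually_le_surfDensity_of_gt_sq` — for `y > μ² = 2 + √2`, `δ ≤ surfDensity n y` eventually**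
  ("… and is positive for `y > y_c`", in the forms the tree's rates support; `μ² = 2 + √2`).

NOT decided here: the existence of the limit density `y ∂ log μ(y)/∂y` (it needs `μ(y) = lim C_n(y)^{1/n}` for `y > y_c`,
Hammersley–Torrie–Whittington 1982, not in the tree for the honeycomb lattice) and eventual positivity on `(y_c, μ²]`.
Label: CONSOLIDATION — the printed sentence on the density, in finite-`n` form, by a different (rate-only) argument.
Lane «pcv-sawmu», seat a-idea-1 g20 (door (c-density), DCS frame). Pure standard axioms.
-/

noncomputable section

open Finset Filter Topology
open scoped BigOperators

namespace Literature.Probability.RandomPlanarGeometry.SAW.HV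

/-! ### Vocabulary -/

/-- The length-`n` fibre: mid-edge half-plane walks from `a` with `n` visited vertices (the index set of `C_n(y)`).
[cite: BeatonBousquetMelouDeGierDuminilCopinGuttmann2014, §3.1 (arXiv v5 p. 8: "the sum runs over half-plane SAWs ω of length k")] -/
def hpFibreN (n : ℕ) : Finset (List HV) := (midWalks (stripV n n)).filter fun P => mwLen P = n

/-- `C_n(y) = Σ_{γ ∈ hpFibreN n} y^{c(γ)}`. [cite: BeatonBousquetMelouDeGierDuminilCopinGuttmann2014, §3.1 (arXiv v5 p. 8: "C_k^+(y) := Σ_{|ω|=k} y^{c(ω)}")] -/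
theorem hpCoeff_eq_sum (n : ℕ) (y : ℝ) : hpCoeff n y = ∑ P ∈ hpFibreN n, y ^ botContacts P := rfl

/-- `c(γ) ≤ n` on the fibre. [cite: BeatonBousquetMelouDeGierDuminilCopinGuttmann2014, §3.1 (arXiv v5 p. 8: "c(ω) denotes the number of contacts of ω with the surface (i.e., the number of vertices of the surface visited by ω)")] -/
theorem botContacts_le_of_mem {n : ℕ} {P : List HV} (hP : P ∈ hpFibreN n) : botContacts P ≤ n := by
  obtain ⟨hPm, hPn⟩ := mem_filter.1 hP
  exact hPn ▸ (mem_midWalks_iff.1 hPm).botContacts_le_mwLen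

/-- `C_n(y) > 0` for `y > 0`, `n ≥ 1` (the surface zig-zag is in the fibre).
[cite: BeatonBousquetMelouDeGierDuminilCopinGuttmann2014, §3.1, proof of Proposition 5 (arXiv v5 p. 9: "zig-zag walks sticking to the surface")] -/
theorem hpCoeff_pos {y : ℝ} (hy : 0 < y) {n : ℕ} (hn : 1 ≤ n) : 0 < hpCoeff n y :=
  (pow_pos hy _).trans_le (pow_half_le_hpCoeff hy.le hn)

/-- **The surface moment `Σ_γ c(γ) y^{c(γ)} = Σ_i i c_n^+(i) y^i = y C_n'(y)`.**
[cite: BeatonBousquetMelouDeGierDuminilCopinGuttmann2014, §3.1, last paragraph (arXiv v5 p. 10: the numerator Σ_i i c_n^+(i) y^i of the mean density; formula as in the arXiv source)] -/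
def surfMoment (n : ℕ) (y : ℝ) : ℝ := ∑ P ∈ hpFibreN n, (botContacts P : ℝ) * y ^ botContacts P

/-- **The mean density of vertices in the surface, `(1/n) Σ_i i c_n^+(i) y^i / Σ_i c_n^+(i) y^i`.**
[cite: BeatonBousquetMelouDeGierDuminilCopinGuttmann2014, §3.1, last paragraph (arXiv v5 p. 10: the mean density of vertices on the surface, (1/n) Σ_i i c_n^+(i) y^i / Σ_i c_n^+(i) y^i = (y/n) ∂ log C_n^+(y)/∂y — formula as in the arXiv source)] -/
def surfDensity (n : ℕ) (y : ℝ) : ℝ := surfMoment n y / (n * hpCoeff n y)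

/-- The tail `Σ_{γ : c(γ) ≥ t} y^{c(γ)}` — the weight of walks with at least `t` surface vertices.
[cite: BeatonBousquetMelouDeGierDuminilCopinGuttmann2014, §3.1, last paragraph (arXiv v5 p. 10: "the density of vertices on the surface is 0 for y < y_c")] -/
def surfTail (n t : ℕ) (y : ℝ) : ℝ := ∑ P ∈ (hpFibreN n).filter (fun P => t ≤ botContacts P), y ^ botContacts P

/-- `surfMoment n y ≥ 0` for `y ≥ 0`. [cite: BeatonBousquetMelouDeGierDuminilCopinGuttmann2014, §3.1, last paragraph (arXiv v5 p. 10)] -/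
theorem surfMoment_nonneg (n : ℕ) {y : ℝ} (hy : 0 ≤ y) : 0 ≤ surfMoment n y :=
  sum_nonneg fun _ _ => mul_nonneg (Nat.cast_nonneg _) (pow_nonneg hy _)

/-- `surfTail n t y ≥ 0` for `y ≥ 0`. [cite: BeatonBousquetMelouDeGierDuminilCopinGuttmann2014, §3.1, last paragraph (arXiv v5 p. 10)] -/
theorem surfTail_nonneg (n t : ℕ) {y : ℝ} (hy : 0 ≤ y) : 0 ≤ surfTail n t y :=
  sum_nonneg fun _ _ => pow_nonneg hy _

/-- `surfTail n t y ≤ C_n(y)` for `y ≥ 0`. [cite: BeatonBousquetMelouDeGierDuminilCopinGuttmann2014, §3.1 (arXiv v5 p. 8: `C_k^+(y)`)] -/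
theorem surfTail_le_hpCoeff (n t : ℕ) {y : ℝ} (hy : 0 ≤ y) : surfTail n t y ≤ hpCoeff n y :=
  sum_le_sum_of_subset_of_nonneg (filter_subset _ _) fun _ _ _ => pow_nonneg hy _

/-- `Σ c y^c ≤ n C_n(y)` (`c ≤ n`). [cite: BeatonBousquetMelouDeGierDuminilCopinGuttmann2014, §3.1 (arXiv v5 p. 8: "c(ω) … the number of vertices of the surface visited by ω")] -/
theorem surfMoment_le_mul (n : ℕ) {y : ℝ} (hy : 0 ≤ y) : surfMoment n y ≤ n * hpCoeff n y := by
  rw [surfMoment, hpCoeff_eq_sum, mul_sum]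
  exact sum_le_sum fun P hP => mul_le_mul_of_nonneg_right (Nat.cast_le.2 (botContacts_le_of_mem hP)) (pow_nonneg hy _)

/-- `0 ≤ surfDensity n y` for `y ≥ 0`. [cite: BeatonBousquetMelouDeGierDuminilCopinGuttmann2014, §3.1, last paragraph (arXiv v5 p. 10: the mean density of vertices on the surface)] -/
theorem surfDensity_nonneg (n : ℕ) {y : ℝ} (hy : 0 ≤ y) : 0 ≤ surfDensity n y :=
  div_nonneg (surfMoment_nonneg n hy) (mul_nonneg (Nat.cast_nonneg _) (hpCoeff_nonneg n hy))

/-- `surfDensity n y ≤ 1` for `y ≥ 0` (a density). [cite: BeatonBousquetMelouDeGierDuminilCopinGuttmann2014, §3.1, last paragraph (arXiv v5 p. 10: the mean density of vertices on the surface)] -/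
theorem surfDensity_le_one (n : ℕ) {y : ℝ} (hy : 0 ≤ y) : surfDensity n y ≤ 1 := by
  rw [surfDensity]
  rcases (mul_nonneg (Nat.cast_nonneg n) (hpCoeff_nonneg n hy)).eq_or_lt with h | h
  · rw [← h, div_zero]; exact zero_le_one
  · exact (div_le_one h).2 (surfMoment_le_mul n hy)

/-! ### Markov splitting and rescaling of the tail -/

/-- **Markov splitting: `Σ c y^c ≤ t · C_n(y) + n · surfTail n t y`.**
[cite: BeatonBousquetMelouDeGierDuminilCopinGuttmann2014, §3.1, last paragraph (arXiv v5 p. 10: "the density of vertices on the surface is 0 for y < y_c")] -/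
theorem surfMoment_le_add (n t : ℕ) {y : ℝ} (hy : 0 ≤ y) :
    surfMoment n y ≤ t * hpCoeff n y + n * surfTail n t y := by
  rw [surfMoment, hpCoeff_eq_sum, surfTail, sum_filter, mul_sum, mul_sum, ← sum_add_distrib]
  refine sum_le_sum fun P hP => ?_
  have hc := botContacts_le_of_mem hP
  have h0 : 0 ≤ y ^ botContacts P := pow_nonneg hy _
  by_cases ht : t ≤ botContacts P
  · rw [if_pos ht]
    have h1 : (botContacts P : ℝ) * y ^ botContacts P ≤ n * y ^ botContacts P :=
      mul_le_mul_of_nonneg_right (Nat.cast_le.2 hc) h0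
    have h2 : (0 : ℝ) ≤ t * y ^ botContacts P := mul_nonneg (Nat.cast_nonneg _) h0
    linarith
  · rw [if_neg ht, mul_zero, add_zero]
    exact mul_le_mul_of_nonneg_right (Nat.cast_le.2 (not_le.1 ht).le) h0

/-- **Rescaling of the tail: `surfTail n t y ≤ (y/y')^t · C_n(y')` for `0 < y ≤ y'`** (`y^c = (y/y')^c y'^c ≤ (y/y')^t y'^c` when `c ≥ t`).
[cite: BeatonBousquetMelouDeGierDuminilCopinGuttmann2014, §3.1 (arXiv v5 p. 8: `C_k^+(y)` "a polynomial in y")] -/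
theorem surfTail_le_pow_mul {y y' : ℝ} (hy : 0 < y) (hyy' : y ≤ y') (n t : ℕ) :
    surfTail n t y ≤ (y / y') ^ t * hpCoeff n y' := by
  have hy' : 0 < y' := hy.trans_le hyy'
  have hq1 : y / y' ≤ 1 := (div_le_one hy').2 hyy'
  have hq0 : 0 ≤ y / y' := div_nonneg hy.le hy'.le
  rw [surfTail, hpCoeff_eq_sum, mul_sum]
  calc ∑ P ∈ (hpFibreN n).filter (fun P => t ≤ botContacts P), y ^ botContacts P
      ≤ ∑ P ∈ (hpFibreN n).filter (fun P => t ≤ botContacts P), (y / y') ^ t * y' ^ botContacts P := by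
        refine sum_le_sum fun P hP => ?_
        have ht : t ≤ botContacts P := (mem_filter.1 hP).2
        calc y ^ botContacts P = (y / y') ^ botContacts P * y' ^ botContacts P := by
              rw [← mul_pow, div_mul_cancel₀ _ hy'.ne']
          _ ≤ (y / y') ^ t * y' ^ botContacts P :=
              mul_le_mul_of_nonneg_right (pow_le_pow_of_le_one hq0 hq1 ht) (pow_nonneg hy'.le _)
    _ ≤ ∑ P ∈ hpFibreN n, (y / y') ^ t * y' ^ botContacts P :=
        sum_le_sum_of_subset_of_nonneg (filter_subset _ _) fun P _ _ =>
          mul_nonneg (pow_nonneg hq0 _) (pow_nonneg hy'.le _)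

/-! ### Below `y_c`: exponentially small tails and density `→ 0` -/

/-- **Exponential tail below `y_c`: for `0 < y < 1 + √2` and `ε > 0` there is `ρ ∈ (0, μ)` with
`surfTail n ⌈εn⌉ y ≤ ρⁿ` eventually** (rescale to `y_c` and use `limsup C_n(y_c)^{1/n} ≤ μ`).
[cite: BeatonBousquetMelouDeGierDuminilCopinGuttmann2014, §3.1, Proposition 5 (arXiv v5 p. 9: "μ(y) = μ if y ≤ y_c") and the last paragraph of §3.1 (p. 10: "the density of vertices on the surface is 0 for y < y_c")] -/
theorem exists_rate_surfTail {y ε : ℝ} (hy0 : 0 < y) (hy : y < 1 + Real.sqrt 2) (hε : 0 < ε) :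
    ∃ ρ : ℝ, 0 < ρ ∧ ρ < hexConnectiveConstant ∧
      ∀ᶠ n : ℕ in atTop, surfTail n ⌈ε * n⌉₊ y ≤ ρ ^ n := by
  have hμ0 : 0 < hexConnectiveConstant := zero_lt_one.trans one_lt_hexConnectiveConstant
  have hyc0 : (0 : ℝ) < 1 + Real.sqrt 2 := hy0.trans hy
  set q : ℝ := y / (1 + Real.sqrt 2) with hq
  have hq0 : 0 < q := div_pos hy0 hyc0
  have hq1 : q < 1 := (div_lt_one hyc0).2 hy
  set b : ℝ := q ^ (ε / 2) with hb
  have hb0 : 0 < b := Real.rpow_pos_of_pos hq0 _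
  have hb1 : b < 1 := Real.rpow_lt_one hq0.le hq1 (by positivity)
  refine ⟨b * hexConnectiveConstant, mul_pos hb0 hμ0, mul_lt_of_lt_one_left hμ0 hb1, ?_⟩
  have hr : hexConnectiveConstant < hexConnectiveConstant / b := by
    rw [lt_div_iff₀ hb0]; exact mul_lt_of_lt_one_right hμ0 hb1
  filter_upwards [growthLe_criticalPoint _ hr] with n hn
  have hqpow : q ^ ⌈ε * n⌉₊ ≤ b ^ (2 * n) := by
    rw [← Real.rpow_natCast q, hb, ← Real.rpow_mul_natCast hq0.le]
    refine Real.rpow_le_rpow_of_exponent_ge hq0 hq1.le ?_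
    calc ε / 2 * ((2 * n : ℕ) : ℝ) = ε * n := by push_cast; ring
      _ ≤ ⌈ε * n⌉₊ := Nat.le_ceil _
  calc surfTail n ⌈ε * n⌉₊ y ≤ q ^ ⌈ε * n⌉₊ * hpCoeff n (1 + Real.sqrt 2) := surfTail_le_pow_mul hy0 hy.le n _
    _ ≤ b ^ (2 * n) * (hexConnectiveConstant / b) ^ n :=
        mul_le_mul hqpow hn (hpCoeff_nonneg n hyc0.le) (pow_nonneg hb0.le _)
    _ = (b * hexConnectiveConstant) ^ n := by
        rw [pow_mul, ← mul_pow]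
        congr 1
        field_simp

/-- **The Boltzmann probability of at least `εn` surface vertices decays exponentially below `y_c`:**
for `0 < y < 1 + √2` and `ε > 0` there is `θ ∈ (0, 1)` with `surfTail n ⌈εn⌉ y / C_n(y) ≤ θⁿ` eventually
(the tail rate `ρ < μ` against the eventual lower rate `liminf C_n(y)^{1/n} ≥ μ`).
[cite: BeatonBousquetMelouDeGierDuminilCopinGuttmann2014, §3.1, Proposition 5 (arXiv v5 p. 9) and the last paragraph of §3.1 (p. 10: "the density of vertices on the surface is 0 for y < y_c")] -/
theorem exists_rate_surfTail_div {y ε : ℝ} (hy0 : 0 < y) (hy : y < 1 + Real.sqrt 2) (hε : 0 < ε) :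
    ∃ θ : ℝ, 0 < θ ∧ θ < 1 ∧
      ∀ᶠ n : ℕ in atTop, surfTail n ⌈ε * n⌉₊ y / hpCoeff n y ≤ θ ^ n := by
  obtain ⟨ρ, hρ0, hρμ, hT⟩ := exists_rate_surfTail hy0 hy hε
  set r : ℝ := (ρ + hexConnectiveConstant) / 2 with hr
  have hρr : ρ < r := by rw [hr]; linarith
  have hrμ : r < hexConnectiveConstant := by rw [hr]; linarith
  have hr0 : 0 < r := hρ0.trans hρr
  refine ⟨ρ / r, div_pos hρ0 hr0, (div_lt_one hr0).2 hρr, ?_⟩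
  filter_upwards [hT, growthGeRate_mu_of_pos hy0 r hr0.le hrμ] with n hTn hCn
  rw [div_pow]
  exact div_le_div₀ (pow_nonneg hρ0.le _) hTn (pow_pos hr0 _) hCn

/-- `surfDensity n y ≤ t/n + surfTail n t y / C_n(y)` (`y > 0`, `n ≥ 1`).
[cite: BeatonBousquetMelouDeGierDuminilCopinGuttmann2014, §3.1, last paragraph (arXiv v5 p. 10: the mean density of vertices on the surface)] -/
theorem surfDensity_le_add {y : ℝ} (hy : 0 < y) {n : ℕ} (hn : 1 ≤ n) (t : ℕ) :
    surfDensity n y ≤ (t : ℝ) / n + surfTail n t y / hpCoeff n y := by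
  have hC := hpCoeff_pos hy hn
  have hn0 : (0 : ℝ) < n := by exact_mod_cast hn
  rw [surfDensity, div_le_iff₀ (mul_pos hn0 hC)]
  have h : ((t : ℝ) / n + surfTail n t y / hpCoeff n y) * (n * hpCoeff n y)
      = t * hpCoeff n y + n * surfTail n t y := by
    field_simp
  rw [h]
  exact surfMoment_le_add n t hy.le

/-- **The density of surface vertices is `0` below `y_c` (finite-`n` form): for `0 < y < 1 + √2`,
`surfDensity n y → 0`.**
[cite: BeatonBousquetMelouDeGierDuminilCopinGuttmann2014, §3.1, last paragraph (arXiv v5 p. 10: "we see that the density of vertices on the surface is 0 for y < y_c")] -/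
theorem tendsto_surfDensity_zero {y : ℝ} (hy0 : 0 < y) (hy : y < 1 + Real.sqrt 2) :
    Tendsto (fun n : ℕ => surfDensity n y) atTop (𝓝 0) := by
  refine tendsto_order.2 ⟨fun a ha => Eventually.of_forall fun n => ha.trans_le (surfDensity_nonneg n hy0.le),
    fun a ha => ?_⟩
  have hε : 0 < a / 3 := by positivity
  obtain ⟨ρ, hρ0, hρμ, hT⟩ := exists_rate_surfTail hy0 hy hε
  set r : ℝ := (ρ + hexConnectiveConstant) / 2 with hr
  have hρr : ρ < r := by rw [hr]; linarith
  have hrμ : r < hexConnectiveConstant := by rw [hr]; linarith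
  have hr0 : 0 < r := hρ0.trans hρr
  have hθ : Tendsto (fun n : ℕ => (ρ / r) ^ n) atTop (𝓝 0) :=
    tendsto_pow_atTop_nhds_zero_of_lt_one (div_nonneg hρ0.le hr0.le) ((div_lt_one hr0).2 hρr)
  have h1 : Tendsto (fun n : ℕ => (1 : ℝ) / n) atTop (𝓝 0) := tendsto_one_div_atTop_nhds_zero_nat
  filter_upwards [hT, growthGeRate_mu_of_pos hy0 r hr0.le hrμ, hθ.eventually (gt_mem_nhds hε),
    h1.eventually (gt_mem_nhds hε), eventually_ge_atTop 1] with n hTn hCn hθn h1n hn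
  have hn0 : (0 : ℝ) < n := by exact_mod_cast hn
  have hi : (⌈a / 3 * n⌉₊ : ℝ) / n < a / 3 + a / 3 := by
    rw [div_lt_iff₀ hn0]
    have h2 := Nat.ceil_lt_add_one (by positivity : 0 ≤ a / 3 * n)
    have h3 : 1 < a / 3 * n := (div_lt_iff₀ hn0).1 h1n
    linarith
  have hii : surfTail n ⌈a / 3 * n⌉₊ y / hpCoeff n y < a / 3 := by
    refine lt_of_le_of_lt ?_ hθn
    rw [div_pow]
    exact div_le_div₀ (pow_nonneg hρ0.le _) hTn (pow_pos hr0 _) hCn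
  calc surfDensity n y ≤ (⌈a / 3 * n⌉₊ : ℝ) / n + surfTail n ⌈a / 3 * n⌉₊ y / hpCoeff n y :=
        surfDensity_le_add hy0 hn _
    _ < a / 3 + a / 3 + a / 3 := add_lt_add hi hii
    _ = a := by ring

/-! ### Above `y_c`: the chord inequality and positive density -/

/-- **Chord inequality (weighted AM–GM, i.e. convexity of `log C_n(eᵗ)`): `(y₀/y)^{surfMoment n y / C_n(y)} ≤ C_n(y₀)/C_n(y)`**
for `y, y₀ > 0`, `n ≥ 1` (weights `y^{c(γ)}/C_n(y)`, values `(y₀/y)^{c(γ)}`).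
[cite: BeatonBousquetMelouDeGierDuminilCopinGuttmann2014, §3.1, Proposition 5 (arXiv v5 p. 9: μ(y) "is a log-convex, non-decreasing function of log y")] -/
theorem rpow_surfDensity_le {y y₀ : ℝ} (hy : 0 < y) (hy₀ : 0 < y₀) {n : ℕ} (hn : 1 ≤ n) :
    (y₀ / y) ^ (surfMoment n y / hpCoeff n y) ≤ hpCoeff n y₀ / hpCoeff n y := by
  have hC := hpCoeff_pos hy hn
  have hq : 0 < y₀ / y := div_pos hy₀ hy
  have hyne : y ≠ 0 := hy.ne'
  have key := Real.geom_mean_le_arith_mean_weighted (hpFibreN n)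
    (fun P => y ^ botContacts P / hpCoeff n y) (fun P => (y₀ / y) ^ (botContacts P : ℝ))
    (fun P _ => div_nonneg (pow_nonneg hy.le _) hC.le)
    (by rw [← sum_div, ← hpCoeff_eq_sum, div_self hC.ne'])
    (fun P _ => (Real.rpow_pos_of_pos hq _).le)
  have hL : ∏ P ∈ hpFibreN n, ((y₀ / y) ^ (botContacts P : ℝ)) ^ (y ^ botContacts P / hpCoeff n y)
      = (y₀ / y) ^ (surfMoment n y / hpCoeff n y) := by
    rw [surfMoment, sum_div, Real.rpow_sum_of_pos hq]
    refine prod_congr rfl fun P _ => ?_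
    rw [← Real.rpow_mul hq.le, mul_div_assoc]
  have hR : ∑ P ∈ hpFibreN n, y ^ botContacts P / hpCoeff n y * (y₀ / y) ^ (botContacts P : ℝ)
      = hpCoeff n y₀ / hpCoeff n y := by
    rw [hpCoeff_eq_sum n y₀, sum_div]
    refine sum_congr rfl fun P _ => ?_
    rw [Real.rpow_natCast, div_mul_eq_mul_div, ← mul_pow, show y * (y₀ / y) = y₀ by field_simp]
  rw [← hL, ← hR]
  exact key

/-- **From a ratio bound to a density bound:** if `0 < y₀ < y` and `C_n(y₀)/C_n(y) ≤ θⁿ` (`n ≥ 1`), then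
`log θ / log (y₀/y) ≤ surfDensity n y` (take logarithms in the chord inequality; for `0 < θ < 1` the bound is positive).
[cite: BeatonBousquetMelouDeGierDuminilCopinGuttmann2014, §3.1, last paragraph (arXiv v5 p. 10: "the density of vertices on the surface … is positive for y > y_c")] -/
theorem le_surfDensity_of_ratio_le {y y₀ θ : ℝ} (hy₀ : 0 < y₀) (hlt : y₀ < y)
    {n : ℕ} (hn : 1 ≤ n) (h : hpCoeff n y₀ / hpCoeff n y ≤ θ ^ n) :
    Real.log θ / Real.log (y₀ / y) ≤ surfDensity n y := by
  have hy : 0 < y := hy₀.trans hlt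
  have hq0 : 0 < y₀ / y := div_pos hy₀ hy
  have hq1 : y₀ / y < 1 := (div_lt_one hy).2 hlt
  have hlq : Real.log (y₀ / y) < 0 := Real.log_neg hq0 hq1
  have hn0 : (0 : ℝ) < n := by exact_mod_cast hn
  have key := (rpow_surfDensity_le hy hy₀ hn).trans h
  have hlog := Real.log_le_log (Real.rpow_pos_of_pos hq0 _) key
  rw [Real.log_rpow hq0, Real.log_pow] at hlog
  have hE : (n : ℝ) * Real.log θ / Real.log (y₀ / y) ≤ surfMoment n y / hpCoeff n y :=
    (div_le_iff_of_neg hlq).2 hlog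
  rw [surfDensity, mul_comm (n : ℝ), ← div_div, le_div_iff₀ hn0]
  calc Real.log θ / Real.log (y₀ / y) * n = n * Real.log θ / Real.log (y₀ / y) := by ring
    _ ≤ surfMoment n y / hpCoeff n y := hE

/-- **Positive density above `y_c`, frequently form: for `y > 1 + √2` there is `δ > 0` with `δ ≤ surfDensity n y` for
infinitely many `n`** (a rate `r > μ` is reached infinitely often at `y`, `growthGt_holds`, while `C_n(y_c) ≤ sⁿ` eventually
for `μ < s < r`, `growthLe_criticalPoint`; then the chord inequality from `y_c` to `y`).
[cite: BeatonBousquetMelouDeGierDuminilCopinGuttmann2014, §3.1, Proposition 5 (arXiv v5 p. 9: "μ(y) > μ if y > y_c") and the last paragraph of §3.1 (p. 10: "the density of vertices on the surface … is positive for y > y_c")] -/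
theorem frequently_le_surfDensity_of_gt {y : ℝ} (hy : 1 + Real.sqrt 2 < y) :
    ∃ δ : ℝ, 0 < δ ∧ ∃ᶠ n : ℕ in atTop, δ ≤ surfDensity n y := by
  have hμ0 : 0 < hexConnectiveConstant := zero_lt_one.trans one_lt_hexConnectiveConstant
  have hy₀ : (0 : ℝ) < 1 + Real.sqrt 2 := by positivity
  have hy0 : 0 < y := hy₀.trans hy
  obtain ⟨r, hμr, hfr⟩ := growthGt_holds hy
  set s : ℝ := (hexConnectiveConstant + r) / 2 with hs
  have hμs : hexConnectiveConstant < s := by rw [hs]; linarith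
  have hsr : s < r := by rw [hs]; linarith
  have hs0 : 0 < s := hμ0.trans hμs
  have hr0 : 0 < r := hs0.trans hsr
  have hθ0 : 0 < s / r := div_pos hs0 hr0
  have hθ1 : s / r < 1 := (div_lt_one hr0).2 hsr
  have hq0 : 0 < (1 + Real.sqrt 2) / y := div_pos hy₀ hy0
  have hq1 : (1 + Real.sqrt 2) / y < 1 := (div_lt_one hy0).2 hy
  refine ⟨Real.log (s / r) / Real.log ((1 + Real.sqrt 2) / y),
    div_pos_of_neg_of_neg (Real.log_neg hθ0 hθ1) (Real.log_neg hq0 hq1), ?_⟩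
  refine (hfr.and_eventually ((growthLe_criticalPoint s hμs).and (eventually_ge_atTop 1))).mono ?_
  rintro n ⟨hrn, hsn, hn⟩
  refine le_surfDensity_of_ratio_le hy₀ hy hn ?_
  rw [div_pow]
  exact div_le_div₀ (pow_nonneg hs0.le _) hsn (pow_pos hr0 _) hrn

/-- **Positive density, eventual form, for `y > μ² = 2 + √2`: there is `δ > 0` with `δ ≤ surfDensity n y` eventually**
(here the zig-zag rate `√y > μ` is an EVENTUAL lower rate, `growthGeRate_sqrt`).
[cite: BeatonBousquetMelouDeGierDuminilCopinGuttmann2014, §3.1, Proposition 5 (arXiv v5 p. 9: "μ(y) ≥ max(μ, √y)") and the last paragraph of §3.1 (p. 10: "the density of vertices on the surface … is positive for y > y_c")] -/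
theorem eventually_le_surfDensity_of_gt_sq {y : ℝ} (hy : hexConnectiveConstant ^ 2 < y) :
    ∃ δ : ℝ, 0 < δ ∧ ∀ᶠ n : ℕ in atTop, δ ≤ surfDensity n y := by
  have hμ0 : 0 < hexConnectiveConstant := zero_lt_one.trans one_lt_hexConnectiveConstant
  have hy₀ : (0 : ℝ) < 1 + Real.sqrt 2 := by positivity
  have hy₀y : 1 + Real.sqrt 2 < y := by
    -- `μ² = 2 + √2` (the tree's `hexConnectiveConstant_sq` of `HexSAWEndpointKesten.lean`, re-derived from `μ = x_c⁻¹` to keep imports light)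
    have h : hexConnectiveConstant ^ 2 = 2 + Real.sqrt 2 := by
      rw [hexConnectiveConstant_eq_inv, inv_pow]
      exact inv_eq_of_mul_eq_one_right hexCriticalFugacity_sq
    linarith
  have hy0 : 0 < y := hy₀.trans hy₀y
  have hμy : hexConnectiveConstant < Real.sqrt y := (Real.lt_sqrt hμ0.le).2 hy
  set r : ℝ := (hexConnectiveConstant + Real.sqrt y) / 2 with hr
  have hμr : hexConnectiveConstant < r := by rw [hr]; linarith
  have hry : r < Real.sqrt y := by rw [hr]; linarith
  have hr0 : 0 < r := hμ0.trans hμr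
  set s : ℝ := (hexConnectiveConstant + r) / 2 with hs
  have hμs : hexConnectiveConstant < s := by rw [hs]; linarith
  have hsr : s < r := by rw [hs]; linarith
  have hs0 : 0 < s := hμ0.trans hμs
  have hθ0 : 0 < s / r := div_pos hs0 hr0
  have hθ1 : s / r < 1 := (div_lt_one hr0).2 hsr
  have hq0 : 0 < (1 + Real.sqrt 2) / y := div_pos hy₀ hy0
  have hq1 : (1 + Real.sqrt 2) / y < 1 := (div_lt_one hy0).2 hy₀y
  refine ⟨Real.log (s / r) / Real.log ((1 + Real.sqrt 2) / y),
    div_pos_of_neg_of_neg (Real.log_neg hθ0 hθ1) (Real.log_neg hq0 hq1), ?_⟩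
  filter_upwards [growthGeRate_sqrt hy0 r hr0.le hry, growthLe_criticalPoint s hμs, eventually_ge_atTop 1]
    with n hrn hsn hn
  refine le_surfDensity_of_ratio_le hy₀ hy₀y hn ?_
  rw [div_pow]
  exact div_le_div₀ (pow_nonneg hs0.le _) hsn (pow_pos hr0 _) hrn

end Literature.Probability.RandomPlanarGeometry.SAW.HV
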